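import Literature.Topology.FourManifolds.TautFoliationsHolonomyCocycle
import Mathlib.Topology.Covering.Basic
import HarnessLib

/-!
# The holonomy covering of the leaves of a `C⁰` codimension-one foliation (germ covering)

Sibling of `TautFoliationsHolonomyCocycle.lean` (the transition germs `γ_{e e'}` of the
foliated cocycle: germs of homeomorphisms of `ℝ`, locally constant along plaques, satisfying
the cocycle identity) and `TautFoliationsLeafTopology.lean` (the leaf space `M^δ`). This file
packages **leaf holonomy** (Hector–Hirsch, *Introduction to the Geometry of Foliations, Part
A*, Ch. III 1.3, 2.1, 2.2; Camacho–Lins Neto, *Geometric Theory of Foliations*, Ch. IV §1;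
Haefliger's germinal holonomy) as a **covering space of the leaf space**, so that the holonomy
of leaf paths, its homotopy invariance and the holonomy representation of `π₁` of a leaf become
instances of Mathlib's theory of covering maps (path lifting, the monodromy theorem):

* `Foliation.IsHomeoGermAt φ t` (**definition**): `φ : ℝ → ℝ` is a germ of homeomorphism at
  `t` (continuous and strictly monotone on an open interval around `t`); stable under
  composition, with an inverse germ (`exists_inverse`); the transition germs `γ_{e e'}` are
  such (`isHomeoGermAt_transition`).
* `Foliation.height e` (**definition**, the distinguished map `h_e = pr₂ ∘ e` of the box `e`)
  and **the change of distinguished maps** `h_{e'} = γ_{e e'} ∘ h_e` near a common point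
  (`height_eventuallyEq_transition_comp_height`; Hector–Hirsch A, Ch. II 2.1.1 (*)).
* `Foliation.IsDistinguishedGerm F z G` (**definition**): the germ `G` at `z ∈ M` of a real
  function is *distinguished* — the germ of `φ ∘ h_e` for a flow box `e ∋ z` of the atlas and
  a homeomorphism germ `φ` at `h_e(z)`, i.e. the germ of a *local first integral* of `F`
  (a distinguished map followed by a local homeomorphism of the transversal). The notion does
  not depend on the box (`IsDistinguishedGerm.exists_eq`), and `φ` is determined as a germ
  (`eventuallyEq_of_comp_height_eq`).
* `Foliation.GermSpace F` (**definition**): the space of distinguished germs at points of `M`,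
  topologised as the *étalé space* generated by the local first integrals
  `q ↦ germ_q (φ ∘ h_e)` along the plaques (`germSection`); `GermSpace.proj : F.GermSpace →
  F.LeafSpace`.
* **`GermSpace.proj` is a covering map of the leaf space** (`isCoveringMap_proj`; Hector–Hirsch
  A, Ch. III 1.3.1–1.3.4 and 2.1.6: the holonomy pseudogroup / "Q_L is a covering"): over the
  plaque `P` of the box `e` at height `t` the germ space is `P × {homeomorphism germs at t}`
  (`trivialization`), reading a distinguished germ at `q ∈ P` through the vertical of `e` at
  `q`; the compatibility of these local product structures over overlapping plaques of two
  boxes is exactly the local constancy of the transition germ along plaques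
  (`transition_eventuallyEq_of_isPreconnected`).

The holonomy of a leaf path `γ` from `p` to `q` is then read off the lift of `γ` to
`F.GermSpace` starting at the germ of `h_{e₀}` at `p` (sibling file to come): its end point is
the germ of `φ ∘ h_{e₁}` at `q` for a homeomorphism germ `φ`, the (inverse) holonomy
`γ_{e₁} → γ_{e₀}` of `γ`; homotopy invariance is the monodromy theorem.

## References

* G. Hector, U. Hirsch, *Introduction to the Geometry of Foliations, Part A*, 2nd ed., Vieweg
  (1986), Ch. II 2.1.1, 2.1.4; Ch. III 1.2, 1.3, 2.1, 2.2 [HectorHirsch1986].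
* C. Camacho, A. Lins Neto, *Geometric Theory of Foliations*, Birkhäuser (1985), Ch. IV §1, §2
  [CamachoLinsNeto1985].
* A. Haefliger, *Variétés feuilletées*, Ann. Scuola Norm. Sup. Pisa 16 (1962) 367–397, §1
  [Haefliger1962].

## Design notes

* A point of `F.GermSpace` is a point `q` of the leaf space together with a germ at `q` (for
  the topology of `M`) of a real function on `M`, which is distinguished. The topology is the
  supremum of the topologies coinduced by the sections `germSection he t hφ : B → F.GermSpace`,
  `b ↦ (e.symm (b, t), germ (φ ∘ h_e))`; maps out of (open subsets of) `F.GermSpace` are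
  continuous iff they are so along every section (`continuousOn_iff_germSection`).
* The fibre of the trivialization over the plaque of `e` at height `t` is the discrete space
  `HomeoGerm t` of homeomorphism germs at `t`; the covering is stated with Mathlib's
  `IsCoveringMap` (fibres `proj ⁻¹' {q}`).
* `B` is assumed nonempty and locally connected where the local product structure is
  established (the germ read through `e` is locally constant along connected pieces of
  plaques); no smoothness, general `M`.
-/
open scoped Topology
open Function Set Filter Topology

namespace Literature.Topology.FourManifolds

namespace Foliation

variable {B : Type*} [TopologicalSpace B] {M : Type*} [TopologicalSpace M]
variable {e e' : OpenPartialHomeomorph M (B × ℝ)} {t : ℝ} {x y z w : M}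

-- BODY
/-! ## Germs of homeomorphisms of the line -/

/-- `φ : ℝ → ℝ` is a **germ of homeomorphism at `t`**: on some open interval around `t` it is
continuous and strictly monotone (increasing or decreasing) — i.e. it restricts to a
homeomorphism between open intervals around `t` and `φ t`. Only the germ of `φ` at `t`
matters. [folklore] -/
def IsHomeoGermAt (φ : ℝ → ℝ) (t : ℝ) : Prop :=
  ∃ ε > (0 : ℝ), ContinuousOn φ (Ioo (t - ε) (t + ε)) ∧
    (StrictMonoOn φ (Ioo (t - ε) (t + ε)) ∨ StrictAntiOn φ (Ioo (t - ε) (t + ε)))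

namespace IsHomeoGermAt

variable {φ φ' χ : ℝ → ℝ} {t : ℝ}

/-- The symmetric open interval of radius `ε > 0` around `t` is a neighbourhood of `t`.
[folklore] -/
theorem Ioo_mem_nhds_of_pos {t ε : ℝ} (hε : 0 < ε) : Ioo (t - ε) (t + ε) ∈ 𝓝 t :=
  Ioo_mem_nhds (by linarith) (by linarith)

/-- A neighbourhood of `t` contains a symmetric open interval around `t`. [folklore] -/
theorem exists_Ioo_subset_of_mem_nhds {t : ℝ} {s : Set ℝ} (hs : s ∈ 𝓝 t) :
    ∃ ε > (0 : ℝ), Ioo (t - ε) (t + ε) ⊆ s := by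
  obtain ⟨ε, hε, h⟩ := Metric.mem_nhds_iff.1 hs
  exact ⟨ε, hε, by rwa [Real.ball_eq_Ioo] at h⟩

/-- Restricting the interval: a homeomorphism germ is continuous and strictly monotone on every
smaller symmetric interval. [folklore] -/
theorem exists_of_le (h : IsHomeoGermAt φ t) :
    ∃ ε > (0 : ℝ), ∀ δ, 0 < δ → δ ≤ ε → ContinuousOn φ (Ioo (t - δ) (t + δ)) ∧
      (StrictMonoOn φ (Ioo (t - δ) (t + δ)) ∨ StrictAntiOn φ (Ioo (t - δ) (t + δ))) := by
  obtain ⟨ε, hε, hc, hm⟩ := h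
  refine ⟨ε, hε, fun δ _ hδε ↦ ?_⟩
  have hsub : Ioo (t - δ) (t + δ) ⊆ Ioo (t - ε) (t + ε) := Ioo_subset_Ioo (by linarith) (by linarith)
  exact ⟨hc.mono hsub, hm.imp (fun h ↦ h.mono hsub) (fun h ↦ h.mono hsub)⟩

/-- A homeomorphism germ is continuous at its base point. [folklore] -/
theorem continuousAt (h : IsHomeoGermAt φ t) : ContinuousAt φ t := by
  obtain ⟨ε, hε, hc, -⟩ := h
  exact hc.continuousAt (Ioo_mem_nhds_of_pos hε)

/-- A homeomorphism germ is injective near its base point. [folklore] -/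
theorem eventually_injective (h : IsHomeoGermAt φ t) : ∃ U ∈ 𝓝 t, InjOn φ U := by
  obtain ⟨ε, hε, -, hm⟩ := h
  exact ⟨_, Ioo_mem_nhds_of_pos hε, hm.elim StrictMonoOn.injOn StrictAntiOn.injOn⟩

/-- A continuous strictly monotone function is a homeomorphism germ at every point. [folklore] -/
theorem of_strictMono (hc : Continuous φ) (hm : StrictMono φ) (t : ℝ) : IsHomeoGermAt φ t :=
  ⟨1, one_pos, hc.continuousOn, Or.inl (hm.strictMonoOn _)⟩

/-- A continuous strictly antitone function is a homeomorphism germ at every point. [folklore] -/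
theorem of_strictAnti (hc : Continuous φ) (hm : StrictAnti φ) (t : ℝ) : IsHomeoGermAt φ t :=
  ⟨1, one_pos, hc.continuousOn, Or.inr (hm.strictAntiOn _)⟩

/-- The identity is a homeomorphism germ. [folklore] -/
theorem id (t : ℝ) : IsHomeoGermAt id t := of_strictMono continuous_id strictMono_id t

/-- The reflection `τ ↦ 2c - τ` is a homeomorphism germ at every point. [folklore] -/
theorem reflect (c t : ℝ) : IsHomeoGermAt (fun τ ↦ 2 * c - τ) t :=
  of_strictAnti (by fun_prop) (fun _ _ h ↦ by linarith) t

/-- **Homeomorphism germs compose**: if `φ` is a homeomorphism germ at `t` and `χ` one at `φ t`,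
then `χ ∘ φ` is a homeomorphism germ at `t`. [folklore] -/
theorem comp (hχ : IsHomeoGermAt χ (φ t)) (hφ : IsHomeoGermAt φ t) : IsHomeoGermAt (χ ∘ φ) t := by
  obtain ⟨ε₂, hε₂, hc₂, hm₂⟩ := hχ
  obtain ⟨ε₁, hε₁, h₁⟩ := hφ.exists_of_le
  -- a small interval around `t` mapped by `φ` into the interval of `χ`
  obtain ⟨δ, hδ, hδsub⟩ := exists_Ioo_subset_of_mem_nhds (inter_mem (Ioo_mem_nhds_of_pos hε₁)
    (hφ.continuousAt.preimage_mem_nhds (Ioo_mem_nhds_of_pos hε₂)))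
  have hδε : Ioo (t - δ) (t + δ) ⊆ Ioo (t - ε₁) (t + ε₁) := fun τ hτ ↦ (hδsub hτ).1
  have hmaps : MapsTo φ (Ioo (t - δ) (t + δ)) (Ioo (φ t - ε₂) (φ t + ε₂)) := fun τ hτ ↦ (hδsub hτ).2
  have hδ₁ : δ ≤ ε₁ := by
    by_contra hlt
    push Not at hlt
    have hmem : t + (ε₁ + δ) / 2 ∈ Ioo (t - δ) (t + δ) := by constructor <;> linarith
    have := (hδε hmem).2
    linarith
  obtain ⟨hc₁, hm₁⟩ := h₁ δ hδ hδ₁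
  refine ⟨δ, hδ, hc₂.comp hc₁ hmaps, ?_⟩
  rcases hm₂ with hm₂ | hm₂ <;> rcases hm₁ with hm₁ | hm₁
  · exact Or.inl (hm₂.comp hm₁ hmaps)
  · exact Or.inr (hm₂.comp_strictAntiOn hm₁ hmaps)
  · exact Or.inr (hm₂.comp_strictMonoOn hm₁ hmaps)
  · exact Or.inl (hm₂.comp hm₁ hmaps)

/-- Homeomorphism germs depend only on the germ. [folklore] -/
theorem congr (hφ : IsHomeoGermAt φ t) (h : φ =ᶠ[𝓝 t] φ') : IsHomeoGermAt φ' t := by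
  obtain ⟨ε₁, hε₁, h₁⟩ := hφ.exists_of_le
  obtain ⟨δ, hδ, hδsub⟩ := exists_Ioo_subset_of_mem_nhds (inter_mem (Ioo_mem_nhds_of_pos hε₁) h)
  have hδε : Ioo (t - δ) (t + δ) ⊆ Ioo (t - ε₁) (t + ε₁) := fun τ hτ ↦ (hδsub hτ).1
  have heq : EqOn φ φ' (Ioo (t - δ) (t + δ)) := fun τ hτ ↦ (hδsub hτ).2
  have hδ₁ : δ ≤ ε₁ := by
    by_contra hlt
    push Not at hlt
    have hmem : t + (ε₁ + δ) / 2 ∈ Ioo (t - δ) (t + δ) := by constructor <;> linarith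
    have := (hδε hmem).2
    linarith
  obtain ⟨hc₁, hm₁⟩ := h₁ δ hδ hδ₁
  refine ⟨δ, hδ, hc₁.congr heq.symm, ?_⟩
  exact hm₁.imp (fun hm ↦ hm.congr heq) (fun hm ↦ hm.congr heq)

/-- **The inverse germ, increasing case.** A function continuous and strictly increasing on an
open interval around `t` has an inverse germ at `φ t`: a function `ψ`, continuous and strictly
increasing near `φ t`, with `ψ ∘ φ = id` near `t` and `φ ∘ ψ = id` near `φ t` (intermediate
value theorem and continuity of monotone functions with interval image). [folklore] -/
theorem exists_inverse_of_strictMonoOn {ε : ℝ} (hε : 0 < ε) (hc : ContinuousOn φ (Ioo (t - ε) (t + ε)))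
    (hm : StrictMonoOn φ (Ioo (t - ε) (t + ε))) :
    ∃ ψ : ℝ → ℝ, IsHomeoGermAt ψ (φ t) ∧ ψ (φ t) = t ∧ ψ ∘ φ =ᶠ[𝓝 t] _root_.id ∧
      φ ∘ ψ =ᶠ[𝓝 (φ t)] _root_.id := by
  classical
  -- a closed interval `[a, b]` around `t` inside the interval
  set a : ℝ := t - ε / 2 with ha
  set b : ℝ := t + ε / 2 with hb
  have hat : a < t := by linarith
  have htb : t < b := by linarith
  have hIcc : Icc a b ⊆ Ioo (t - ε) (t + ε) := Icc_subset_Ioo (by linarith) (by linarith)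
  have hIoo : Ioo a b ⊆ Ioo (t - ε) (t + ε) := Ioo_subset_Icc_self.trans hIcc
  have hma : StrictMonoOn φ (Ioo a b) := hm.mono hIoo
  have hφa : φ a < φ t := hm (hIcc (left_mem_Icc.2 (by linarith))) (hIcc ⟨hat.le, htb.le⟩) hat
  have hφb : φ t < φ b := hm (hIcc ⟨hat.le, htb.le⟩) (hIcc (right_mem_Icc.2 (by linarith))) htb
  -- the image interval `J = (φ a, φ b)` is covered by `φ '' (a, b)`
  have hJ : Ioo (φ a) (φ b) ⊆ φ '' Ioo a b := intermediate_value_Ioo (by linarith) (hc.mono hIcc)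
  -- the inverse on `(a, b)`
  set ψ : ℝ → ℝ := invFunOn φ (Ioo a b) with hψ
  have hleft : ∀ x ∈ Ioo a b, ψ (φ x) = x := fun x hx ↦ hma.injOn.leftInvOn_invFunOn hx
  have hright : ∀ y ∈ Ioo (φ a) (φ b), φ (ψ y) = y ∧ ψ y ∈ Ioo a b := fun y hy ↦ by
    obtain ⟨x, hx, hxy⟩ := hJ hy
    exact ⟨invFunOn_eq ⟨x, hx, hxy⟩, invFunOn_mem ⟨x, hx, hxy⟩⟩
  have hψm : StrictMonoOn ψ (Ioo (φ a) (φ b)) := by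
    intro y₁ hy₁ y₂ hy₂ hlt
    obtain ⟨h₁, h₁'⟩ := hright y₁ hy₁
    obtain ⟨h₂, h₂'⟩ := hright y₂ hy₂
    by_contra hle
    push Not at hle
    have : φ (ψ y₂) ≤ φ (ψ y₁) := hma.monotoneOn h₂' h₁' hle
    rw [h₁, h₂] at this
    exact absurd hlt (not_lt.2 this)
  have himage : ψ '' Ioo (φ a) (φ b) = Ioo a b := by
    refine Subset.antisymm ?_ fun x hx ↦ ?_
    · rintro _ ⟨y, hy, rfl⟩
      exact (hright y hy).2
    · have hxI : x ∈ Ioo (t - ε) (t + ε) := hIoo hx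
      have h₁ : φ a < φ x := hm (hIcc (left_mem_Icc.2 (by linarith))) hxI hx.1
      have h₂ : φ x < φ b := hm hxI (hIcc (right_mem_Icc.2 (by linarith))) hx.2
      exact ⟨φ x, ⟨h₁, h₂⟩, hleft x hx⟩
  have hψc : ∀ y ∈ Ioo (φ a) (φ b), ContinuousAt ψ y := fun y hy ↦
    continuousAt_of_monotoneOn_of_image_mem_nhds hψm.monotoneOn (Ioo_mem_nhds hy.1 hy.2)
      (by rw [himage]; exact Ioo_mem_nhds (hright y hy).2.1 (hright y hy).2.2)
  -- a symmetric interval around `φ t` inside `J`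
  set ε' : ℝ := min (φ t - φ a) (φ b - φ t) with hε'
  have hε'₀ : 0 < ε' := lt_min (by linarith) (by linarith)
  have hsub : Ioo (φ t - ε') (φ t + ε') ⊆ Ioo (φ a) (φ b) := fun y hy ↦
    ⟨by linarith [hy.1, min_le_left (φ t - φ a) (φ b - φ t)],
      by linarith [hy.2, min_le_right (φ t - φ a) (φ b - φ t)]⟩
  refine ⟨ψ, ⟨ε', hε'₀, continuousOn_of_forall_continuousAt fun y hy ↦ hψc y (hsub hy),
    Or.inl (hψm.mono hsub)⟩, hleft t ⟨hat, htb⟩, ?_, ?_⟩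
  · exact Filter.eventually_of_mem (Ioo_mem_nhds hat htb) fun x hx ↦ hleft x hx
  · exact Filter.eventually_of_mem (Ioo_mem_nhds hφa hφb) fun y hy ↦ (hright y hy).1

/-- **The inverse germ** of a homeomorphism germ: a homeomorphism germ `ψ` at `φ t` with
`ψ (φ t) = t`, `ψ ∘ φ = id` near `t` and `φ ∘ ψ = id` near `φ t` (the decreasing case is reduced
to the increasing one by the reflection `τ ↦ 2t - τ`). [folklore] -/
theorem exists_inverse (hφ : IsHomeoGermAt φ t) :
    ∃ ψ : ℝ → ℝ, IsHomeoGermAt ψ (φ t) ∧ ψ (φ t) = t ∧ ψ ∘ φ =ᶠ[𝓝 t] _root_.id ∧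
      φ ∘ ψ =ᶠ[𝓝 (φ t)] _root_.id := by
  obtain ⟨ε, hε, hc, hm | hm⟩ := hφ
  · exact exists_inverse_of_strictMonoOn hε hc hm
  · -- reflect the argument about `t`
    set r : ℝ → ℝ := fun τ ↦ 2 * t - τ with hrdef
    have hr : ∀ τ, r (r τ) = τ := fun τ ↦ by simp only [hrdef]; ring
    have hrt : r t = t := by simp only [hrdef]; ring
    have hrc : Continuous r := by fun_prop
    have hmaps : MapsTo r (Ioo (t - ε) (t + ε)) (Ioo (t - ε) (t + ε)) := fun τ hτ ↦
      ⟨by simp only [hrdef]; linarith [hτ.2], by simp only [hrdef]; linarith [hτ.1]⟩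
    have hra : StrictAntiOn r (Ioo (t - ε) (t + ε)) := fun _ _ _ _ h ↦ by
      simp only [hrdef]; linarith
    have hc' : ContinuousOn (φ ∘ r) (Ioo (t - ε) (t + ε)) := hc.comp hrc.continuousOn hmaps
    have hm' : StrictMonoOn (φ ∘ r) (Ioo (t - ε) (t + ε)) := hm.comp hra hmaps
    obtain ⟨ψ', hψ', hval, h₁, h₂⟩ := exists_inverse_of_strictMonoOn (φ := φ ∘ r) hε hc' hm'
    have hφrt : (φ ∘ r) t = φ t := by
      show φ (r t) = φ t
      rw [hrt]
    refine ⟨r ∘ ψ', ?_, ?_, ?_, ?_⟩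
    · rw [hφrt] at hψ'
      exact (reflect t _).comp hψ'
    · show r (ψ' (φ t)) = t
      rw [← hφrt, hval, hrt]
    · have hrT : Tendsto r (𝓝 t) (𝓝 t) := by
        have h := hrc.tendsto t
        rwa [hrt] at h
      filter_upwards [h₁.comp_tendsto hrT] with x hx
      simp only [comp_apply, id_eq, hr] at hx ⊢
      rw [hx, hr]
    · rw [hφrt] at h₂
      exact h₂

/-- A homeomorphism germ maps the neighbourhood filter of `t` onto that of `φ t`. [folklore] -/
theorem map_nhds_eq (hφ : IsHomeoGermAt φ t) : Filter.map φ (𝓝 t) = 𝓝 (φ t) := by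
  obtain ⟨ψ, hψ, hval, -, hψ₂⟩ := hφ.exists_inverse
  refine le_antisymm hφ.continuousAt fun s hs ↦ ?_
  rw [Filter.mem_map] at hs
  have hψt : Tendsto ψ (𝓝 (φ t)) (𝓝 t) := by
    have h := hψ.continuousAt
    rwa [ContinuousAt, hval] at h
  filter_upwards [hψt.eventually hs, hψ₂] with σ hσ₁ hσ₂
  have : φ (ψ σ) = σ := hσ₂
  rw [this] at hσ₁
  exact hσ₁

end IsHomeoGermAt

variable (F : Foliation B M)

/-- **The transition germs of the atlas are homeomorphism germs** (inverse germ `γ_{e' e}`).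
[folklore] -/
theorem isHomeoGermAt_transition (he : e ∈ F.atlas) (he' : e' ∈ F.atlas) (hz : z ∈ e.source)
    (hz' : z ∈ e'.source) : IsHomeoGermAt (transition e e' z) (e z).2 := by
  obtain ⟨ε, hε, hsrc, hm⟩ := F.exists_strictMonoOn_or_strictAntiOn_transition he he' hz hz'
  exact ⟨ε, hε, fun τ hτ ↦ (F.continuousAt_transition_of_mem he (hsrc τ hτ)).continuousWithinAt, hm⟩

/-! ## Distinguished maps and distinguished germs -/

/-- The **distinguished map** (transverse coordinate, height function) `h_e = pr₂ ∘ e` of the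
flow box `e` (Hector–Hirsch A, Ch. II 2.1.6 (ii)). [folklore] -/
def height (e : OpenPartialHomeomorph M (B × ℝ)) : M → ℝ := fun w ↦ (e w).2

/-- Unfolding lemma for `height`. [folklore] -/
@[simp] theorem height_apply (e : OpenPartialHomeomorph M (B × ℝ)) (w : M) : height e w = (e w).2 := rfl

/-- A distinguished map is continuous on the source of its box. [folklore] -/
theorem continuousAt_height (hz : z ∈ e.source) : ContinuousAt (height e) z :=
  continuous_snd.continuousAt.comp (e.continuousAt hz)

/-- `h_e ∘ (vertical of e) = id`. [folklore] -/
theorem height_comp_vertical (he : e ∈ F.atlas) (b : B) : height e ∘ vertical e b = id := by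
  funext τ
  simp only [comp_apply, height_apply, F.apply_vertical he, id]

/-- The vertical of `e` through `z` tends to `z` at the height of `z`. [folklore] -/
theorem tendsto_vertical (he : e ∈ F.atlas) (hz : z ∈ e.source) :
    Tendsto (vertical e (e z).1) (𝓝 (e z).2) (𝓝 z) := by
  have h := (F.continuous_vertical he (e z).1).continuousAt (x := (e z).2)
  rwa [ContinuousAt, vertical_height hz] at h

/-- The distinguished map of `e` tends to `h_e(z)` at `z ∈ e.source`. [folklore] -/
theorem tendsto_height (hz : z ∈ e.source) : Tendsto (height e) (𝓝 z) (𝓝 (e z).2) :=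
  continuousAt_height hz

/-- **Change of distinguished maps**: near a point `z` common to two flow boxes of the atlas,
`h_{e'} = γ_{e e'} ∘ h_e` — the form `(x, t) ↦ (α(x, t), γ(t))` of the changes of coordinates
(Hector–Hirsch A, Ch. II 2.1.1 (*)), with `γ = γ_{e e'}` the transition germ at `z`.
[cite: HectorHirsch1986, Ch. II 2.1.1] -/
theorem height_eventuallyEq_transition_comp_height (he : e ∈ F.atlas) (he' : e' ∈ F.atlas)
    (hz : z ∈ e.source) (hz' : z ∈ e'.source) :
    height e' =ᶠ[𝓝 z] transition e e' z ∘ height e := by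
  obtain ⟨U, hU, hUe⟩ := F.locally_plaque e he e' he' z ⟨hz, hz'⟩
  have hn : U ∩ (e.source ∩ e'.source) ∈ 𝓝 z :=
    inter_mem hU (inter_mem (e.open_source.mem_nhds hz) (e'.open_source.mem_nhds hz'))
  -- the projection of `w` to the vertical through `z` along the plaques of `e`
  have hc : ContinuousAt (fun w ↦ vertical e (e z).1 (height e w)) z := by
    have h₁ : ContinuousAt (vertical e (e z).1) (height e z) :=
      (F.continuous_vertical he (e z).1).continuousAt
    exact h₁.comp (continuousAt_height hz)
  have hcz : vertical e (e z).1 (height e z) = z := vertical_height hz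
  have h₂ : ∀ᶠ w in 𝓝 z, vertical e (e z).1 (height e w) ∈ U ∩ (e.source ∩ e'.source) :=
    hc.preimage_mem_nhds (by rw [hcz]; exact hn)
  filter_upwards [hn, h₂] with w hw₁ hw₂
  simp only [comp_apply, transition_apply, height_apply]
  refine (hUe _ hw₂ _ hw₁ ?_).symm
  rw [F.apply_vertical he]
  rfl

/-- **Distinguished germs.** The germ `G` at `z` of a real function on `M` is *distinguished*
for `F` if it is the germ of `φ ∘ h_e` for some flow box `e ∋ z` of the atlas and some
homeomorphism germ `φ` at `h_e(z)` — the germ of a local first integral of `F` at `z` (a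
distinguished map followed by a local homeomorphism of the transversal; Hector–Hirsch A,
Ch. II 2.1.6 (ii), Ch. III 1.2–1.3). [cite: HectorHirsch1986, Ch. III 1.3] -/
def IsDistinguishedGerm (z : M) (G : Germ (𝓝 z) ℝ) : Prop :=
  ∃ e ∈ F.atlas, z ∈ e.source ∧ ∃ φ : ℝ → ℝ, IsHomeoGermAt φ (e z).2 ∧ G = ↑(φ ∘ height e)

/-- The germ of a distinguished map is distinguished. [folklore] -/
theorem isDistinguishedGerm_height (he : e ∈ F.atlas) (hz : z ∈ e.source) :
    F.IsDistinguishedGerm z ↑(height e) :=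
  ⟨e, he, hz, id, IsHomeoGermAt.id _, rfl⟩

/-- The germ of `φ ∘ h_e`, `φ` a homeomorphism germ at `h_e(z)`, is distinguished. [folklore] -/
theorem isDistinguishedGerm_comp_height (he : e ∈ F.atlas) (hz : z ∈ e.source) {φ : ℝ → ℝ}
    (hφ : IsHomeoGermAt φ (e z).2) : F.IsDistinguishedGerm z ↑(φ ∘ height e) :=
  ⟨e, he, hz, φ, hφ, rfl⟩

variable {F} in
/-- **Distinguished germs do not depend on the flow box**: a distinguished germ at `z` is the
germ of `φ ∘ h_{e'}` for *every* flow box `e' ∋ z` of the atlas and a suitable homeomorphism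
germ `φ` (by the change of distinguished maps `h_e = γ_{e' e} ∘ h_{e'}`, the transition germ
being a homeomorphism germ). [folklore] -/
theorem IsDistinguishedGerm.exists_eq {G : Germ (𝓝 z) ℝ} (hG : F.IsDistinguishedGerm z G)
    (he' : e' ∈ F.atlas) (hz' : z ∈ e'.source) :
    ∃ φ : ℝ → ℝ, IsHomeoGermAt φ (e' z).2 ∧ G = ↑(φ ∘ height e') := by
  obtain ⟨e, he, hz, φ, hφ, rfl⟩ := hG
  refine ⟨φ ∘ transition e' e z, ?_, ?_⟩
  · refine IsHomeoGermAt.comp ?_ (F.isHomeoGermAt_transition he' he hz' hz)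
    rwa [transition_apply_height e hz']
  · rw [Germ.coe_eq]
    have h := F.height_eventuallyEq_transition_comp_height he' he hz' hz
    exact h.fun_comp φ

/-- **The homeomorphism germ of a distinguished germ is determined**: if `φ ∘ h_e` and
`ψ ∘ h_e` have the same germ at `z ∈ e.source`, then `φ` and `ψ` have the same germ at
`h_e(z)` (compose with the vertical of `e` through `z`, a right inverse of `h_e` tending to
`z`). [folklore] -/
theorem eventuallyEq_of_comp_height_eq (he : e ∈ F.atlas) (hz : z ∈ e.source) {φ ψ : ℝ → ℝ}
    (h : (↑(φ ∘ height e) : Germ (𝓝 z) ℝ) = ↑(ψ ∘ height e)) : φ =ᶠ[𝓝 (e z).2] ψ := by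
  rw [Germ.coe_eq] at h
  have h' := h.comp_tendsto (F.tendsto_vertical he hz)
  have hφ : (φ ∘ height e) ∘ vertical e (e z).1 = φ := by
    rw [comp_assoc, F.height_comp_vertical he, comp_id]
  have hψ : (ψ ∘ height e) ∘ vertical e (e z).1 = ψ := by
    rw [comp_assoc, F.height_comp_vertical he, comp_id]
  rwa [hφ, hψ] at h'

/-! ## The space of distinguished germs -/

/-- **The germ space** of the foliation: the distinguished germs at the points of `M` — pairs
of a point `q` of the leaf space and a distinguished germ at `q` (germ for the topology of
`M`). With the étalé topology below, `GermSpace.proj` is the holonomy covering of the leaf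
space (Hector–Hirsch A, Ch. III 1.3, 2.1). [cite: HectorHirsch1986, Ch. III 2.1] -/
structure GermSpace (F : Foliation B M) where
  /-- The base point, a point of the leaf space. -/
  pt : F.LeafSpace
  /-- The germ at the base point. -/
  germ : Germ (𝓝 (ofLeafSpace pt)) ℝ
  /-- The germ is distinguished. -/
  isDist : F.IsDistinguishedGerm (ofLeafSpace pt) germ

namespace GermSpace

variable {F}

/-- Two points of the germ space over the same base point with equal germs are equal.
[folklore] -/
theorem ext_of_eq {q : F.LeafSpace} {G G' : Germ (𝓝 (ofLeafSpace q)) ℝ}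
    {h : F.IsDistinguishedGerm (ofLeafSpace q) G} {h' : F.IsDistinguishedGerm (ofLeafSpace q) G'}
    (hG : G = G') : (⟨q, G, h⟩ : F.GermSpace) = ⟨q, G', h'⟩ := by
  subst hG
  rfl

/-- Two points of the germ space with equal base points and (heterogeneously) equal germs are
equal. [folklore] -/
theorem ext_heq {d d' : F.GermSpace} (h₁ : d.pt = d'.pt) (h₂ : HEq d.germ d'.germ) : d = d' := by
  obtain ⟨p, G, hG⟩ := d
  obtain ⟨p', G', hG'⟩ := d'
  cases h₁
  cases h₂
  rfl

/-- The germs of one function at equal points are heterogeneously equal. [folklore] -/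
theorem coe_germ_heq {z z' : M} (h : z = z') (f : M → ℝ) :
    HEq ((↑f : Germ (𝓝 z) ℝ)) ((↑f : Germ (𝓝 z') ℝ)) := by
  subst h
  exact HEq.rfl

/-- The projection of the germ space to the leaf space. [folklore] -/
def proj (d : F.GermSpace) : F.LeafSpace := d.pt

/-- Unfolding lemma for `proj`. [folklore] -/
@[simp] theorem proj_mk (q : F.LeafSpace) (G : Germ (𝓝 (ofLeafSpace q)) ℝ)
    (h : F.IsDistinguishedGerm (ofLeafSpace q) G) : proj (⟨q, G, h⟩ : F.GermSpace) = q := rfl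

end GermSpace

/-- **Local first integrals as sections of the germ space**: for a flow box `e` of the atlas,
a height `t` and a homeomorphism germ `φ` at `t`, the section `b ↦ germ of φ ∘ h_e` at the
point `e.symm (b, t)` of the plaque of `e` at height `t`. [folklore] -/
def germSection (he : e ∈ F.atlas) (t : ℝ) {φ : ℝ → ℝ} (hφ : IsHomeoGermAt φ t) (b : B) :
    F.GermSpace :=
  ⟨F.leafPlaqueMap e t b, ↑(φ ∘ height e),
    F.isDistinguishedGerm_comp_height he (F.plaqueMap_mem_source he t b)
      (by rw [F.apply_plaqueMap he]; exact hφ)⟩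

/-- The projection of a section is the plaque map. [folklore] -/
@[simp] theorem proj_germSection (he : e ∈ F.atlas) (t : ℝ) {φ : ℝ → ℝ} (hφ : IsHomeoGermAt φ t)
    (b : B) : (F.germSection he t hφ b).proj = F.leafPlaqueMap e t b := rfl

/-- The base point of a section is the plaque map. [folklore] -/
@[simp] theorem germSection_pt (he : e ∈ F.atlas) (t : ℝ) {φ : ℝ → ℝ} (hφ : IsHomeoGermAt φ t)
    (b : B) : (F.germSection he t hφ b).pt = F.leafPlaqueMap e t b := rfl

/-- The germ of a section is that of `φ ∘ h_e`. [folklore] -/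
@[simp] theorem germSection_germ (he : e ∈ F.atlas) (t : ℝ) {φ : ℝ → ℝ} (hφ : IsHomeoGermAt φ t)
    (b : B) : (F.germSection he t hφ b).germ = ↑(φ ∘ height e) := rfl

/-- **The étalé topology of the germ space**: the finest topology for which all sections
`germSection he t hφ : B → F.GermSpace` (local first integrals along plaques) are continuous.
[folklore] -/
instance GermSpace.instTopologicalSpace : TopologicalSpace F.GermSpace :=
  ⨆ (e : OpenPartialHomeomorph M (B × ℝ)) (he : e ∈ F.atlas) (t : ℝ) (φ : ℝ → ℝ)
    (hφ : IsHomeoGermAt φ t), TopologicalSpace.coinduced (F.germSection he t hφ) ‹TopologicalSpace B›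

variable {F} in
/-- Open sets of the germ space: a set is open iff its preimage under every section is open
in `B`. [folklore] -/
theorem GermSpace.isOpen_iff {s : Set F.GermSpace} :
    IsOpen s ↔ ∀ (e : OpenPartialHomeomorph M (B × ℝ)) (he : e ∈ F.atlas) (t : ℝ) (φ : ℝ → ℝ)
      (hφ : IsHomeoGermAt φ t), IsOpen (F.germSection he t hφ ⁻¹' s) := by
  simp only [isOpen_iSup_iff, isOpen_coinduced]

/-- The sections of the germ space are continuous. [folklore] -/
theorem continuous_germSection (he : e ∈ F.atlas) (t : ℝ) {φ : ℝ → ℝ} (hφ : IsHomeoGermAt φ t) :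
    Continuous (F.germSection he t hφ) :=
  continuous_def.2 fun _ hs ↦ GermSpace.isOpen_iff.1 hs e he t φ hφ

variable {F} in
/-- **Maps out of the germ space are continuous iff they are continuous along all sections.**
[folklore] -/
theorem GermSpace.continuous_iff {Z : Type*} [TopologicalSpace Z] {g : F.GermSpace → Z} :
    Continuous g ↔ ∀ (e : OpenPartialHomeomorph M (B × ℝ)) (he : e ∈ F.atlas) (t : ℝ) (φ : ℝ → ℝ)
      (hφ : IsHomeoGermAt φ t), Continuous (g ∘ F.germSection he t hφ) := by
  constructor
  · intro hg e he t φ hφ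
    exact hg.comp (F.continuous_germSection he t hφ)
  · intro h
    refine continuous_def.2 fun s hs ↦ GermSpace.isOpen_iff.2 fun e he t φ hφ ↦ ?_
    exact hs.preimage (h e he t φ hφ)

variable {F} in
/-- **Maps out of an open subset of the germ space are continuous iff they are continuous
along all sections** (on the preimages of the open subset). [folklore] -/
theorem GermSpace.continuousOn_iff {Z : Type*} [TopologicalSpace Z] {g : F.GermSpace → Z}
    {O : Set F.GermSpace} (hO : IsOpen O) :
    ContinuousOn g O ↔ ∀ (e : OpenPartialHomeomorph M (B × ℝ)) (he : e ∈ F.atlas) (t : ℝ)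
      (φ : ℝ → ℝ) (hφ : IsHomeoGermAt φ t),
        ContinuousOn (g ∘ F.germSection he t hφ) (F.germSection he t hφ ⁻¹' O) := by
  constructor
  · intro hg e he t φ hφ
    exact hg.comp (F.continuous_germSection he t hφ).continuousOn (mapsTo_preimage _ _)
  · intro h
    rw [continuousOn_open_iff hO]
    intro V hV
    refine GermSpace.isOpen_iff.2 fun e he t φ hφ ↦ ?_
    have h' := (continuousOn_open_iff (hO.preimage (F.continuous_germSection he t hφ))).1
      (h e he t φ hφ) V hV
    rwa [preimage_inter]

variable {F} in
/-- **The projection of the germ space is continuous** (along a section it is a plaque map).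
[folklore] -/
theorem GermSpace.continuous_proj : Continuous (GermSpace.proj : F.GermSpace → F.LeafSpace) :=
  GermSpace.continuous_iff.2 fun _ he t _ _ ↦ F.continuous_leafPlaqueMap he t

/-! ## Homeomorphism germs as a discrete space; reading a germ through a box -/

/-- The **homeomorphism germs at `t`**, as a type: the germs at `t` of functions that are
homeomorphism germs at `t`. It carries the discrete topology. [folklore] -/
def HomeoGerm (t : ℝ) : Type := {Φ : Germ (𝓝 t) ℝ // ∃ φ : ℝ → ℝ, IsHomeoGermAt φ t ∧ Φ = ↑φ}

/-- The discrete topology on the homeomorphism germs. [folklore] -/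
instance HomeoGerm.instTopologicalSpace (t : ℝ) : TopologicalSpace (HomeoGerm t) := ⊥

/-- The homeomorphism germs form a discrete space. [folklore] -/
instance HomeoGerm.instDiscreteTopology (t : ℝ) : DiscreteTopology (HomeoGerm t) := ⟨rfl⟩

/-- The homeomorphism germs are nonempty (the identity). [folklore] -/
instance HomeoGerm.instNonempty (t : ℝ) : Nonempty (HomeoGerm t) :=
  ⟨⟨↑(id : ℝ → ℝ), id, IsHomeoGermAt.id t, rfl⟩⟩

/-- The homeomorphism germ class of a homeomorphism germ. [folklore] -/
def HomeoGerm.mk {t : ℝ} (φ : ℝ → ℝ) (hφ : IsHomeoGermAt φ t) : HomeoGerm t := ⟨↑φ, φ, hφ, rfl⟩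

/-- The underlying germ of `HomeoGerm.mk`. [folklore] -/
@[simp] theorem HomeoGerm.val_mk {t : ℝ} (φ : ℝ → ℝ) (hφ : IsHomeoGermAt φ t) :
    (HomeoGerm.mk φ hφ : HomeoGerm t).1 = ↑φ := rfl

/-- **Reading a germ through a flow box**: the germ at `h_e(z)` obtained from a germ at `z`
by composing with the vertical of `e` through `z` (for `z` on the plaque of `e` at height
`t`, a germ at `t`). On distinguished germs `φ ∘ h_e` it returns `φ`. [folklore] -/
def readGerm (he : e ∈ F.atlas) (hz : z ∈ plaque e t) (G : Germ (𝓝 z) ℝ) : Germ (𝓝 t) ℝ :=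
  G.compTendsto (vertical e (e z).1) (by
    have h := F.tendsto_vertical he hz.1
    rwa [hz.2] at h)

/-- Reading the germ of `φ ∘ h_e` through `e` gives `φ`. [folklore] -/
theorem readGerm_coe_comp_height (he : e ∈ F.atlas) (hz : z ∈ plaque e t) (φ : ℝ → ℝ) :
    F.readGerm he hz ↑(φ ∘ height e) = (↑φ : Germ (𝓝 t) ℝ) := by
  rw [readGerm, Germ.coe_compTendsto, comp_assoc, F.height_comp_vertical he, comp_id]

/-- Reading a germ of the form `f ∘ g` gives `f ∘ g ∘ vertical`. [folklore] -/
theorem readGerm_coe (he : e ∈ F.atlas) (hz : z ∈ plaque e t) (f : M → ℝ) :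
    F.readGerm he hz ↑f = (↑(f ∘ vertical e (e z).1) : Germ (𝓝 t) ℝ) := by
  rw [readGerm, Germ.coe_compTendsto]

/-- **Writing a germ through a flow box**: the germ at `z` of `Φ ∘ h_e` for a germ `Φ` at
`h_e(z) = t`. [folklore] -/
def writeGerm (hz : z ∈ plaque e t) (Φ : Germ (𝓝 t) ℝ) : Germ (𝓝 z) ℝ :=
  Φ.compTendsto (height e) (by
    have h := tendsto_height (e := e) hz.1
    rwa [hz.2] at h)

/-- Writing `φ` through `e` gives the germ of `φ ∘ h_e`. [folklore] -/
theorem writeGerm_coe (hz : z ∈ plaque e t) (φ : ℝ → ℝ) :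
    writeGerm hz (↑φ : Germ (𝓝 t) ℝ) = (↑(φ ∘ height e) : Germ (𝓝 z) ℝ) := by
  rw [writeGerm, Germ.coe_compTendsto]

/-- Reading after writing is the identity. [folklore] -/
theorem readGerm_writeGerm (he : e ∈ F.atlas) (hz : z ∈ plaque e t) (Φ : Germ (𝓝 t) ℝ) :
    F.readGerm he hz (writeGerm hz Φ) = Φ := by
  refine Φ.inductionOn fun φ ↦ ?_
  rw [writeGerm_coe, F.readGerm_coe_comp_height he hz]

/-- **Writing after reading is the identity on distinguished germs** (a distinguished germ is
constant along the plaques near its base point, so it is recovered from its restriction to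
the vertical). [folklore] -/
theorem writeGerm_readGerm (he : e ∈ F.atlas) (hz : z ∈ plaque e t) {G : Germ (𝓝 z) ℝ}
    (hG : F.IsDistinguishedGerm z G) : writeGerm hz (F.readGerm he hz G) = G := by
  obtain ⟨φ, -, rfl⟩ := hG.exists_eq he hz.1
  rw [F.readGerm_coe_comp_height he hz, writeGerm_coe]

/-- A distinguished germ read through a box is a homeomorphism germ. [folklore] -/
theorem exists_readGerm_eq (he : e ∈ F.atlas) (hz : z ∈ plaque e t) {G : Germ (𝓝 z) ℝ}
    (hG : F.IsDistinguishedGerm z G) :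
    ∃ φ : ℝ → ℝ, IsHomeoGermAt φ t ∧ F.readGerm he hz G = ↑φ := by
  obtain ⟨φ, hφ, rfl⟩ := hG.exists_eq he hz.1
  rw [hz.2] at hφ
  exact ⟨φ, hφ, F.readGerm_coe_comp_height he hz φ⟩

/-- A homeomorphism germ written through a box is a distinguished germ. [folklore] -/
theorem isDistinguishedGerm_writeGerm (he : e ∈ F.atlas) (hz : z ∈ plaque e t) (Φ : HomeoGerm t) :
    F.IsDistinguishedGerm z (writeGerm hz Φ.1) := by
  obtain ⟨Φ, φ, hφ, rfl⟩ := Φ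
  rw [writeGerm_coe]
  rw [← hz.2] at hφ
  exact F.isDistinguishedGerm_comp_height he hz.1 hφ

/-! ## The local product structure over a plaque -/

section Trivialization

/-- **The germ read through `e` is locally constant along the plaques of `e`** (on the germ
space): for a section `germSection he' t' hφ'` of another box and a parameter `b₀` whose point
lies on the plaque `P` of `e` at height `t`, nearby parameters `b` give points of `P` at which
the section's germ, read through `e`, is the same germ at `t` — it is `φ' ∘ γ_{e e'}` read at
the point, and the transition germ is locally constant along `P`
(`transition_eventuallyEq_of_isPreconnected`). [folklore] -/
theorem eventually_readGerm_germSection_eq [LocallyConnectedSpace B] (he : e ∈ F.atlas)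
    (he' : e' ∈ F.atlas) {t t' : ℝ}
    {φ' : ℝ → ℝ} (hφ' : IsHomeoGermAt φ' t') {b₀ : B}
    (hb₀ : plaqueMap e' t' b₀ ∈ plaque e t) :
    ∀ᶠ b in 𝓝 b₀, ∃ hb : plaqueMap e' t' b ∈ plaque e t,
      F.readGerm he hb (F.germSection he' t' hφ' b).germ =
        F.readGerm he hb₀ (F.germSection he' t' hφ' b₀).germ := by
  -- the parameters whose point lies on the plaque `P` of `e` form an open set
  have hO : IsOpen {b : B | plaqueMap e' t' b ∈ plaque e t} :=
    (F.isOpen_preimage_plaque_leafSpace he t).preimage (F.continuous_leafPlaqueMap he' t')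
  -- a connected neighbourhood of `b₀` inside it
  obtain ⟨W, ⟨hWo, hb₀W, hWc⟩, hWsub⟩ :=
    (LocallyConnectedSpace.open_connected_basis b₀).mem_iff.1 (hO.mem_nhds hb₀)
  filter_upwards [hWo.mem_nhds hb₀W] with b hbW
  have hb : plaqueMap e' t' b ∈ plaque e t := hWsub hbW
  refine ⟨hb, ?_⟩
  -- `φ' ∘ h_{e'} ∘ vertical_e = φ' ∘ γ_{e e'}` and the transition germ is constant along `W`
  have key := F.transition_eventuallyEq_of_isPreconnected he he' (C := plaqueMap e' t' '' W)
    (hWc.isPreconnected.image _ (F.continuous_plaqueMap he' t').continuousOn)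
    (by rintro _ ⟨c, hc, rfl⟩; exact hWsub hc)
    (by rintro _ ⟨c, -, rfl⟩; exact F.plaqueMap_mem_source he' t' c)
    (mem_image_of_mem _ hbW) (mem_image_of_mem _ hb₀W)
  show ((↑((φ' ∘ height e') ∘ vertical e (e (plaqueMap e' t' b)).1)) : Germ (𝓝 t) ℝ) =
    ↑((φ' ∘ height e') ∘ vertical e (e (plaqueMap e' t' b₀)).1)
  rw [Germ.coe_eq]
  exact key.fun_comp φ'

/-- The plaque of `e` at height `t`, in the leaf space, as the base set of the local product
structure. [folklore] -/
theorem isOpen_proj_preimage_plaque (he : e ∈ F.atlas) (t : ℝ) :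
    IsOpen (GermSpace.proj ⁻¹' (ofLeafSpace ⁻¹' plaque e t) : Set F.GermSpace) :=
  (F.isOpen_preimage_plaque_leafSpace he t).preimage GermSpace.continuous_proj

/-- **The local product structure of the germ space over a plaque** (forward map): a
distinguished germ at a point `q` of the plaque `P` of `e` at height `t` is sent to `q` and
the homeomorphism germ at `t` obtained by reading it through `e`. [folklore] -/
noncomputable def trivToFun (he : e ∈ F.atlas) (t : ℝ)
    (d : (GermSpace.proj ⁻¹' (ofLeafSpace ⁻¹' plaque e t) : Set F.GermSpace)) :
    (ofLeafSpace ⁻¹' plaque e t : Set F.LeafSpace) × HomeoGerm t :=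
  (⟨d.1.pt, d.2⟩, ⟨F.readGerm he (d.2 : ofLeafSpace d.1.pt ∈ plaque e t) d.1.germ,
    F.exists_readGerm_eq he (d.2 : ofLeafSpace d.1.pt ∈ plaque e t) d.1.isDist⟩)

/-- **The local product structure of the germ space over a plaque** (inverse map): a point
`q` of the plaque and a homeomorphism germ `Φ` at `t` give the distinguished germ `Φ ∘ h_e`
at `q`. [folklore] -/
def trivInvFun (he : e ∈ F.atlas) (t : ℝ)
    (qΦ : (ofLeafSpace ⁻¹' plaque e t : Set F.LeafSpace) × HomeoGerm t) :
    (GermSpace.proj ⁻¹' (ofLeafSpace ⁻¹' plaque e t) : Set F.GermSpace) :=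
  ⟨⟨qΦ.1, writeGerm (qΦ.1.2 : ofLeafSpace (qΦ.1 : F.LeafSpace) ∈ plaque e t) qΦ.2.1,
    F.isDistinguishedGerm_writeGerm he (qΦ.1.2 : ofLeafSpace (qΦ.1 : F.LeafSpace) ∈ plaque e t) qΦ.2⟩,
    qΦ.1.2⟩

/-- `trivInvFun` is a left inverse of `trivToFun`. [folklore] -/
theorem trivInvFun_trivToFun (he : e ∈ F.atlas) (t : ℝ)
    (d : (GermSpace.proj ⁻¹' (ofLeafSpace ⁻¹' plaque e t) : Set F.GermSpace)) :
    F.trivInvFun he t (F.trivToFun he t d) = d := by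
  obtain ⟨⟨q, G, hG⟩, hd⟩ := d
  have hd₀ : ofLeafSpace q ∈ plaque e t := hd
  apply Subtype.ext
  exact GermSpace.ext_of_eq (F.writeGerm_readGerm he hd₀ hG)

/-- `trivInvFun` is a right inverse of `trivToFun`. [folklore] -/
theorem trivToFun_trivInvFun (he : e ∈ F.atlas) (t : ℝ)
    (qΦ : (ofLeafSpace ⁻¹' plaque e t : Set F.LeafSpace) × HomeoGerm t) :
    F.trivToFun he t (F.trivInvFun he t qΦ) = qΦ := by
  obtain ⟨⟨q, hq⟩, Φ, hΦ⟩ := qΦ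
  have hq₀ : ofLeafSpace q ∈ plaque e t := hq
  refine Prod.ext rfl ?_
  exact Subtype.ext (F.readGerm_writeGerm he hq₀ Φ)

/-- **Continuity of the local product structure** (forward): along a section of another box
`e'`, the point moves continuously and the germ read through `e` is locally constant
(`eventually_readGerm_germSection_eq`). [folklore] -/
theorem continuous_trivToFun [Nonempty B] [LocallyConnectedSpace B] (he : e ∈ F.atlas) (t : ℝ) :
    Continuous (F.trivToFun he t) := by
  classical
  -- extend to the whole germ space by a junk value and use the criterion along sections
  set O : Set F.GermSpace := GermSpace.proj ⁻¹' (ofLeafSpace ⁻¹' plaque e t) with hOdef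
  have hO : IsOpen O := F.isOpen_proj_preimage_plaque he t
  obtain ⟨b₁⟩ := ‹Nonempty B›
  let junk : (ofLeafSpace ⁻¹' plaque e t : Set F.LeafSpace) × HomeoGerm t :=
    (⟨F.leafPlaqueMap e t b₁, F.plaqueMap_mem_plaque he t b₁⟩, Classical.arbitrary _)
  let g : F.GermSpace → (ofLeafSpace ⁻¹' plaque e t : Set F.LeafSpace) × HomeoGerm t :=
    fun d ↦ if h : d ∈ O then F.trivToFun he t ⟨d, h⟩ else junk
  have hg : ∀ d : O, g d = F.trivToFun he t d := fun d ↦ dif_pos d.2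
  suffices H : ContinuousOn g O by
    have h := H.restrict
    refine h.congr fun d ↦ ?_
    exact hg d
  refine (GermSpace.continuousOn_iff hO).2 fun e' he' t' φ' hφ' ↦ ?_
  have hS : IsOpen (F.germSection he' t' hφ' ⁻¹' O) :=
    hO.preimage (F.continuous_germSection he' t' hφ')
  have hg' : ∀ b (hb : F.germSection he' t' hφ' b ∈ O),
      g (F.germSection he' t' hφ' b) = F.trivToFun he t ⟨_, hb⟩ := fun b hb ↦ dif_pos hb
  refine continuousOn_of_forall_continuousAt fun b₀ hb₀ ↦ ?_
  have hb₀' : plaqueMap e' t' b₀ ∈ plaque e t := hb₀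
  have hev : ∀ᶠ b in 𝓝 b₀, b ∈ F.germSection he' t' hφ' ⁻¹' O := hS.mem_nhds hb₀
  show ContinuousAt (fun b ↦ ((g (F.germSection he' t' hφ' b)).1,
    (g (F.germSection he' t' hφ' b)).2)) b₀
  refine ContinuousAt.prodMk ?_ ?_
  · -- the point moves continuously along the plaque map of `e'`
    refine (IsInducing.subtypeVal.continuousAt_iff).2 ?_
    refine (F.continuous_leafPlaqueMap he' t').continuousAt.congr ?_
    filter_upwards [hev] with b hb
    simp only [comp_apply, hg' b hb]
    rfl
  · -- the germ read through `e` is locally constant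
    have hc : ContinuousAt (fun _ : B ↦ (g (F.germSection he' t' hφ' b₀)).2) b₀ :=
      continuousAt_const
    refine hc.congr ?_
    filter_upwards [hev, F.eventually_readGerm_germSection_eq he he' hφ' hb₀'] with b hb ⟨hb', hbe⟩
    rw [hg' b hb, hg' b₀ hb₀]
    apply Subtype.ext
    exact hbe.symm

/-- **The inverse local product structure is given by the sections**: for a homeomorphism
germ `φ` at `t` and a point `q` of the plaque, `trivInvFun (q, [φ])` is the value of the
section `germSection he t hφ` at the `B`-coordinate of `q`. [folklore] -/
theorem coe_trivInvFun_mk (he : e ∈ F.atlas) (t : ℝ) {φ : ℝ → ℝ} (hφ : IsHomeoGermAt φ t)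
    (q : (ofLeafSpace ⁻¹' plaque e t : Set F.LeafSpace)) :
    (F.trivInvFun he t (q, HomeoGerm.mk φ hφ) : F.GermSpace) =
      F.germSection he t hφ (e (ofLeafSpace (q : F.LeafSpace))).1 := by
  obtain ⟨q, hq⟩ := q
  have hq₀ : ofLeafSpace q ∈ plaque e t := hq
  have hq' : F.leafPlaqueMap e t (e (ofLeafSpace q)).1 = q :=
    (ofLeafSpace (F := F)).injective (plaqueMap_fst_eq hq₀)
  refine GermSpace.ext_heq hq'.symm ?_
  show HEq (writeGerm hq₀ (↑φ : Germ (𝓝 t) ℝ))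
    ((↑(φ ∘ height e)) : Germ (𝓝 (ofLeafSpace (F.leafPlaqueMap e t (e (ofLeafSpace q)).1))) ℝ)
  rw [writeGerm_coe]
  exact GermSpace.coe_germ_heq (congrArg ofLeafSpace hq').symm (φ ∘ height e)

/-- **Continuity of the local product structure** (inverse): for a fixed homeomorphism germ
the inverse is a local first integral along the plaque, i.e. a section of the germ space
composed with the plaque chart. [folklore] -/
theorem continuous_trivInvFun (he : e ∈ F.atlas) (t : ℝ) : Continuous (F.trivInvFun he t) := by
  refine continuous_prod_of_discrete_right.2 fun Φ ↦ ?_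
  obtain ⟨Φ, φ, hφ, rfl⟩ := Φ
  have hcont : Continuous fun q : (ofLeafSpace ⁻¹' plaque e t : Set F.LeafSpace) ↦
      F.germSection he t hφ (e (ofLeafSpace (q : F.LeafSpace))).1 :=
    (F.continuous_germSection he t hφ).comp (continuous_fst.comp
      (e.continuousOn.comp_continuous (F.continuous_ofLeafSpace.comp continuous_subtype_val)
        fun q ↦ (q.2 : ofLeafSpace (q : F.LeafSpace) ∈ plaque e t).1))
  refine (IsInducing.subtypeVal.continuous_iff).2 ?_
  convert hcont using 1
  funext q
  exact F.coe_trivInvFun_mk he t hφ q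

/-- **The germ space is locally the product of a plaque with the discrete space of
homeomorphism germs**: the local product structure over the plaque of `e` at height `t`, a
homeomorphism `proj ⁻¹' P ≃ₜ P × HomeoGerm t` over `P` (Hector–Hirsch A, Ch. III 1.3.1–1.3.4:
the germs of the local submersions along a plaque form a product). [folklore] -/
noncomputable def trivialization [Nonempty B] [LocallyConnectedSpace B] (he : e ∈ F.atlas) (t : ℝ) :
    (GermSpace.proj ⁻¹' (ofLeafSpace ⁻¹' plaque e t) : Set F.GermSpace) ≃ₜ
      (ofLeafSpace ⁻¹' plaque e t : Set F.LeafSpace) × HomeoGerm t where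
  toFun := F.trivToFun he t
  invFun := F.trivInvFun he t
  left_inv := F.trivInvFun_trivToFun he t
  right_inv := F.trivToFun_trivInvFun he t
  continuous_toFun := F.continuous_trivToFun he t
  continuous_invFun := F.continuous_trivInvFun he t

/-- The forward local product structure: the point and the germ read through `e`. [folklore] -/
theorem trivialization_apply [Nonempty B] [LocallyConnectedSpace B] (he : e ∈ F.atlas) (t : ℝ)
    (d : (GermSpace.proj ⁻¹' (ofLeafSpace ⁻¹' plaque e t) : Set F.GermSpace)) :
    F.trivialization he t d = F.trivToFun he t d := rfl

/-- The inverse local product structure: the germ written through `e`. [folklore] -/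
theorem trivialization_symm_apply [Nonempty B] [LocallyConnectedSpace B] (he : e ∈ F.atlas) (t : ℝ)
    (qΦ : (ofLeafSpace ⁻¹' plaque e t : Set F.LeafSpace) × HomeoGerm t) :
    (F.trivialization he t).symm qΦ = F.trivInvFun he t qΦ := rfl

/-- The second component of the forward local product structure is the germ read through
`e`. [folklore] -/
theorem trivToFun_snd_val (he : e ∈ F.atlas) (t : ℝ)
    (d : (GermSpace.proj ⁻¹' (ofLeafSpace ⁻¹' plaque e t) : Set F.GermSpace)) :
    (F.trivToFun he t d).2.1 =
      F.readGerm he (d.2 : ofLeafSpace d.1.pt ∈ plaque e t) d.1.germ := rfl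

/-- The local product structure lies over the identity of the plaque. [folklore] -/
theorem trivialization_fst [Nonempty B] [LocallyConnectedSpace B] (he : e ∈ F.atlas) (t : ℝ)
    (d : (GermSpace.proj ⁻¹' (ofLeafSpace ⁻¹' plaque e t) : Set F.GermSpace)) :
    ((F.trivialization he t d).1 : F.LeafSpace) = GermSpace.proj (d : F.GermSpace) := rfl

/-- **Every point of the leaf space is evenly covered by the germ space**, with fibre the
homeomorphism germs at its height in a flow box of the atlas around it. [folklore] -/
theorem isEvenlyCovered_proj [Nonempty B] [LocallyConnectedSpace B] (he : e ∈ F.atlas) {q : F.LeafSpace}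
    (hq : ofLeafSpace q ∈ e.source) :
    IsEvenlyCovered (GermSpace.proj : F.GermSpace → F.LeafSpace) q (HomeoGerm (e (ofLeafSpace q)).2) :=
  ⟨inferInstance, ofLeafSpace ⁻¹' plaque e (e (ofLeafSpace q)).2,
    (mem_plaque_self hq : ofLeafSpace q ∈ plaque e (e (ofLeafSpace q)).2),
    F.isOpen_preimage_plaque_leafSpace he _, F.isOpen_proj_preimage_plaque he _,
    F.trivialization he _, F.trivialization_fst he _⟩

/-- **The germ space is a covering space of the leaf space** (`GermSpace.proj` is a covering
map): the holonomy covering of the leaves of a `C⁰` codimension-one foliation (Hector–Hirsch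
A, Ch. III 2.1, 2.2; Camacho–Lins Neto, Ch. IV §1–§2). Consequently leaf paths lift uniquely
to the germ space (continuation of local first integrals along leaf paths), homotopic leaf
paths have lifts with the same end point (the monodromy theorem), and `π₁` of a leaf acts on
the homeomorphism germs of a transversal — Mathlib's `IsCoveringMap.liftPath`,
`IsCoveringMap.liftPath_apply_one_eq_of_homotopicRel`, `IsCoveringMap.monodromy`.
[cite: HectorHirsch1986, Ch. III 2.2.1] -/
theorem isCoveringMap_proj [Nonempty B] [LocallyConnectedSpace B] :
    IsCoveringMap (GermSpace.proj : F.GermSpace → F.LeafSpace) := by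
  intro q
  obtain ⟨e, he, hq⟩ := F.exists_mem_source (ofLeafSpace q)
  exact (F.isEvenlyCovered_proj he hq).to_isEvenlyCovered_preimage

end Trivialization

end Foliation

end Literature.Topology.FourManifolds
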